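import Mathlib
import Summits.Ventures.PercRepro2.V1SeriesClosure

/-! # The graded Hall families G_k and V2_k: series closure, and parallel closure of G_k
(seat mine-b, cell pub-perc-repro2; conjectures/MINE-B.md §20.13)

For a level `k ≥ 2` and a labelled poset `(X, ≤, r, b)`:
* `GDom k r b` — every lower set has non-negative mass for `gw k = [r = 1 ∧ b ≥ k−1] − b·[r = 0 ∧ b ≥ k]`
  (the Hall form of the row (U_k): sources at red level 0 and blue level ≥ k, targets at red level 1 and blue
  level ≥ k−1; `k = 1` is `DownDom` of V1ParallelClosure.lean);
* `VDom k r b` — the same for `vw k = [b = k−1 ∧ r ≥ 1] − b·[r = 0 ∧ b ≥ k]` (targets at blue level exactly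
  `k−1`; `k = 2` is the down-form of (V2)).

Series composition (minimum labels): `gDom_ser` — `GDom k ∧ VDom k` on both parts gives `GDom k` on the
product; `vDom_ser` — `VDom k` on both parts gives `VDom k` on the product.  Both by a pointwise
certificate with integer weights (`2k`, `2k − 1`, `k`, `1`) found by an exact Farkas LP and verified for
all labels `≤ 10` in the seat's code (`phiG`, `phiV`, `pointwiseG`, `pointwiseV`).
Parallel composition (sum labels): `gDom_par` — `GDom j` for all `1 ≤ j ≤ k` on both parts gives `GDom k`
on the product, by the pointwise inequality `w ≥ [r_y = 0]·gw (k − b_y) (x) + [r_x = 0]·gw (k − b_x) (y)`. -/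

namespace Summit.Ventures.PercRepro2.UHClosure

open Finset

variable {X Y : Type*}


/-- the weight of `G_k` at labels `(a, c)`: `[a = 1 ∧ c ≥ k−1] − c·[a = 0 ∧ c ≥ k]` -/
def gw (k a c : ℕ) : ℤ := (if a = 1 ∧ k - 1 ≤ c then 1 else 0) - (if a = 0 ∧ k ≤ c then (c : ℤ) else 0)
/-- the weight of `V2_k` at labels `(a, c)`: `[c = k−1 ∧ a ≥ 1] − c·[a = 0 ∧ c ≥ k]` -/
def vw (k a c : ℕ) : ℤ := (if c = k - 1 ∧ 1 ≤ a then 1 else 0) - (if a = 0 ∧ k ≤ c then (c : ℤ) else 0)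
/-- the weight of `G_k` on the series product at labels `(a,c)`, `(ρ,β)` -/
def wgser (k a c ρ β : ℕ) : ℤ :=
  (if min a ρ = 1 ∧ k - 1 ≤ min c β then 1 else 0) - (if min a ρ = 0 ∧ k ≤ min c β then ((min c β : ℕ) : ℤ) else 0)
/-- `2k` times the multiplier of `G_k` charged by a fibre with labels `(ρ, β)` -/
def lamA (k ρ β : ℕ) : ℤ := if 2 ≤ ρ then (if k ≤ β then 2 * (k : ℤ) else if β + 1 = k then 1 else 0) else if ρ = 1 then (if k ≤ β then 1 else 0) else 0
/-- `2k` times the multiplier of `V2_k` charged by a fibre with labels `(ρ, β)` -/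
def lamB (k ρ β : ℕ) : ℤ := if 2 ≤ ρ then 0 else if ρ = 1 then (if k ≤ β then 2 * (k : ℤ) - 1 else if β + 1 = k then 1 else 0) else (if k ≤ β then (k : ℤ) else 0)
/-- `2k` times the certificate weight charged by a fibre `(ρ, β)` to a point `(a, c)` (target `G_k`) -/
def phiG (k ρ β a c : ℕ) : ℤ := lamA k ρ β * gw k a c + lamB k ρ β * vw k a c

/-- `G_k` vanishes at red level ≥ 2 -/
lemma gw_ge2 (k a c : ℕ) (h : 2 ≤ a) : gw k a c = 0 := by unfold gw; simp [show a ≠ 1 by omega, show a ≠ 0 by omega]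
/-- `G_k` at red level 1 -/
lemma gw_one (k c : ℕ) : gw k 1 c = if k - 1 ≤ c then 1 else 0 := by unfold gw; simp
/-- `G_k` at red level 0 -/
lemma gw_zero (k c : ℕ) : gw k 0 c = -(if k ≤ c then (c : ℤ) else 0) := by unfold gw; simp
/-- `V2_k` at red level ≥ 1 -/
lemma vw_pos (k a c : ℕ) (h : 1 ≤ a) : vw k a c = if c = k - 1 then 1 else 0 := by unfold vw; simp [h, show a ≠ 0 by omega]
/-- `V2_k` at red level 0 -/
lemma vw_zero (k c : ℕ) : vw k 0 c = -(if k ≤ c then (c : ℤ) else 0) := by unfold vw; simp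
/-- the `G` multiplier at red level ≥ 2 -/
lemma lamA_ge2 (k ρ β : ℕ) (h : 2 ≤ ρ) : lamA k ρ β = if k ≤ β then 2 * (k : ℤ) else if β + 1 = k then 1 else 0 := by unfold lamA; simp [h]
/-- the `G` multiplier at red level 1 -/
lemma lamA_one (k β : ℕ) : lamA k 1 β = if k ≤ β then 1 else 0 := by unfold lamA; simp
/-- the `G` multiplier at red level 0 -/
lemma lamA_zero (k β : ℕ) : lamA k 0 β = 0 := by unfold lamA; simp
/-- the `V` multiplier at red level ≥ 2 -/
lemma lamB_ge2 (k ρ β : ℕ) (h : 2 ≤ ρ) : lamB k ρ β = 0 := by unfold lamB; simp [h]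
/-- the `V` multiplier at red level 1 -/
lemma lamB_one (k β : ℕ) : lamB k 1 β = if k ≤ β then 2 * (k : ℤ) - 1 else if β + 1 = k then 1 else 0 := by unfold lamB; simp
/-- the `V` multiplier at red level 0 -/
lemma lamB_zero (k β : ℕ) : lamB k 0 β = if k ≤ β then (k : ℤ) else 0 := by unfold lamB; simp

/-- the product weight when both red labels are ≥ 2: zero -/
lemma wgser_gg (k a c ρ β : ℕ) (ha : 2 ≤ a) (hρ : 2 ≤ ρ) : wgser k a c ρ β = 0 := by
  unfold wgser; simp [show ¬ min a ρ = 1 by omega, show ¬ min a ρ = 0 by omega]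

section cases
variable (k c β : ℕ) (hk : 2 ≤ k)
include hk

/-- the pointwise certificate, both red levels 0 -/
lemma pw_00 : phiG k 0 β 0 c + phiG k 0 c 0 β ≤ 2 * (k : ℤ) * wgser k 0 c 0 β := by
  have hk0 : (0 : ℤ) ≤ k := by positivity
  unfold phiG wgser; simp only [lamA_zero, lamB_zero, gw_zero, vw_zero, min_self]
  rcases le_total c β with h | h
  · rw [min_eq_left h]; have hp : (k : ℤ) * c ≤ k * β := mul_le_mul_of_nonneg_left (by exact_mod_cast h) hk0
    simp; split_ifs <;> first | (exfalso; omega) | nlinarith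
  · rw [min_eq_right h]; have hp : (k : ℤ) * β ≤ k * c := mul_le_mul_of_nonneg_left (by exact_mod_cast h) hk0
    simp; split_ifs <;> first | (exfalso; omega) | nlinarith

/-- the pointwise certificate, red levels 0 and 1 -/
lemma pw_01 : phiG k 1 β 0 c + phiG k 0 c 1 β ≤ 2 * (k : ℤ) * wgser k 0 c 1 β := by
  have hk0 : (0 : ℤ) ≤ k := by positivity
  unfold phiG wgser; simp only [lamA_zero, lamB_zero, lamA_one, lamB_one, gw_zero, vw_zero, gw_one, vw_pos _ _ _ le_rfl]
  rcases le_total c β with h | h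
  · rw [min_eq_left h]; have hp : (k : ℤ) * c ≤ k * β := mul_le_mul_of_nonneg_left (by exact_mod_cast h) hk0
    simp; split_ifs <;> first | (exfalso; omega) | nlinarith
  · rw [min_eq_right h]; have hp : (k : ℤ) * β ≤ k * c := mul_le_mul_of_nonneg_left (by exact_mod_cast h) hk0
    simp; split_ifs <;> first | (exfalso; omega) | nlinarith

/-- the pointwise certificate, both red levels 1 -/
lemma pw_11 : phiG k 1 β 1 c + phiG k 1 c 1 β ≤ 2 * (k : ℤ) * wgser k 1 c 1 β := by
  have hk0 : (0 : ℤ) ≤ k := by positivity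
  unfold phiG wgser; simp only [lamA_one, lamB_one, gw_one, vw_pos _ _ _ le_rfl, min_self]
  rcases le_total c β with h | h
  · rw [min_eq_left h]; simp; split_ifs <;> first | (exfalso; omega) | nlinarith
  · rw [min_eq_right h]; simp; split_ifs <;> first | (exfalso; omega) | nlinarith

/-- the pointwise certificate, red levels 0 and ≥ 2 -/
lemma pw_0g (ρ : ℕ) (hρ : 2 ≤ ρ) : phiG k ρ β 0 c + phiG k 0 c ρ β ≤ 2 * (k : ℤ) * wgser k 0 c ρ β := by
  have hk0 : (0 : ℤ) ≤ k := by positivity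
  unfold phiG wgser; simp only [lamA_zero, lamB_zero, lamA_ge2 _ _ _ hρ, lamB_ge2 _ _ _ hρ, gw_zero, vw_zero, gw_ge2 _ _ _ hρ, vw_pos _ _ _ (by omega : 1 ≤ ρ), min_eq_left (Nat.zero_le ρ)]
  rcases le_total c β with h | h
  · rw [min_eq_left h]; have hp : (k : ℤ) * c ≤ k * β := mul_le_mul_of_nonneg_left (by exact_mod_cast h) hk0
    simp; split_ifs <;> first | (exfalso; omega) | nlinarith
  · rw [min_eq_right h]; have hp : (k : ℤ) * β ≤ k * c := mul_le_mul_of_nonneg_left (by exact_mod_cast h) hk0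
    simp; split_ifs <;> first | (exfalso; omega) | nlinarith

/-- the pointwise certificate, red levels 1 and ≥ 2 -/
lemma pw_1g (ρ : ℕ) (hρ : 2 ≤ ρ) : phiG k ρ β 1 c + phiG k 1 c ρ β ≤ 2 * (k : ℤ) * wgser k 1 c ρ β := by
  unfold phiG wgser; simp only [lamA_one, lamB_one, lamA_ge2 _ _ _ hρ, lamB_ge2 _ _ _ hρ, gw_one, gw_ge2 _ _ _ hρ, vw_pos _ _ _ (by omega : 1 ≤ ρ), vw_pos _ _ _ le_rfl, min_eq_left (show 1 ≤ ρ by omega)]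
  rcases le_total c β with h | h
  · rw [min_eq_left h]; simp; split_ifs <;> first | (exfalso; omega) | nlinarith
  · rw [min_eq_right h]; simp; split_ifs <;> first | (exfalso; omega) | nlinarith

end cases

/-- the two charges commute -/
lemma phi_comm (k ρ β a c : ℕ) : phiG k ρ β a c + phiG k a c ρ β = phiG k a c ρ β + phiG k ρ β a c := add_comm _ _
/-- the product weight is symmetric in the factors -/
lemma wgser_comm (k a c ρ β : ℕ) : wgser k a c ρ β = wgser k ρ β a c := by unfold wgser; rw [min_comm a ρ, min_comm c β]

/-- **The pointwise certificate for the series closure of `G_k`**. -/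
theorem pointwiseG (k a c ρ β : ℕ) (hk : 2 ≤ k) :
    phiG k ρ β a c + phiG k a c ρ β ≤ 2 * (k : ℤ) * wgser k a c ρ β := by
  rcases Nat.lt_or_ge a 2 with ha | ha <;> rcases Nat.lt_or_ge ρ 2 with hρ | hρ
  · interval_cases a <;> interval_cases ρ
    · exact pw_00 k c β hk
    · exact pw_01 k c β hk
    · rw [phi_comm, wgser_comm]; exact pw_01 k β c hk
    · exact pw_11 k c β hk
  · interval_cases a
    · exact pw_0g k c β hk ρ hρ
    · exact pw_1g k c β hk ρ hρ
  · interval_cases ρ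
    · rw [phi_comm, wgser_comm]; exact pw_0g k β c hk a ha
    · rw [phi_comm, wgser_comm]; exact pw_1g k β c hk a ha
  · rw [wgser_gg k a c ρ β ha hρ]
    unfold phiG; simp [gw_ge2 _ _ _ ha, gw_ge2 _ _ _ hρ, lamB_ge2 _ _ _ ha, lamB_ge2 _ _ _ hρ]


/-! ### The `V2_k` certificate -/

/-- the weight of `V2_k` on the series product -/
def wvser (k a c ρ β : ℕ) : ℤ :=
  (if min c β = k - 1 ∧ 1 ≤ min a ρ then 1 else 0) - (if min a ρ = 0 ∧ k ≤ min c β then ((min c β : ℕ) : ℤ) else 0)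

/-- `2k` times the multiplier of `V2_k` charged by a fibre `(ρ, β)` (target `V2_k`) -/
def lamV (k ρ β : ℕ) : ℤ :=
  if 1 ≤ ρ then (if k ≤ β then 2 * (k : ℤ) else if β + 1 = k then 1 else 0) else (if k ≤ β then (k : ℤ) else 0)

/-- `2k` times the certificate weight for the target `V2_k` -/
def phiV (k ρ β a c : ℕ) : ℤ := lamV k ρ β * vw k a c

/-- the `V` multiplier at red level ≥ 1 -/
lemma lamV_pos (k ρ β : ℕ) (h : 1 ≤ ρ) : lamV k ρ β = if k ≤ β then 2 * (k : ℤ) else if β + 1 = k then 1 else 0 := by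
  unfold lamV; simp [h]
/-- the `V` multiplier at red level 0 -/
lemma lamV_zero (k β : ℕ) : lamV k 0 β = if k ≤ β then (k : ℤ) else 0 := by unfold lamV; simp

section casesV
variable (k c β : ℕ) (hk : 2 ≤ k)
include hk

/-- the `V` certificate, both red levels 0 -/
lemma pv_00 : phiV k 0 β 0 c + phiV k 0 c 0 β ≤ 2 * (k : ℤ) * wvser k 0 c 0 β := by
  have hk0 : (0 : ℤ) ≤ k := by positivity
  unfold phiV wvser; simp only [lamV_zero, vw_zero, min_self]
  rcases le_total c β with h | h
  · rw [min_eq_left h]; have hp : (k : ℤ) * c ≤ k * β := mul_le_mul_of_nonneg_left (by exact_mod_cast h) hk0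
    simp; split_ifs <;> first | (exfalso; omega) | nlinarith
  · rw [min_eq_right h]; have hp : (k : ℤ) * β ≤ k * c := mul_le_mul_of_nonneg_left (by exact_mod_cast h) hk0
    simp; split_ifs <;> first | (exfalso; omega) | nlinarith

/-- the `V` certificate, red levels 0 and ≥ 1 -/
lemma pv_0p (ρ : ℕ) (hρ : 1 ≤ ρ) : phiV k ρ β 0 c + phiV k 0 c ρ β ≤ 2 * (k : ℤ) * wvser k 0 c ρ β := by
  have hk0 : (0 : ℤ) ≤ k := by positivity
  unfold phiV wvser; simp only [lamV_zero, lamV_pos _ _ _ hρ, vw_zero, vw_pos _ _ _ hρ, min_eq_left (Nat.zero_le ρ)]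
  rcases le_total c β with h | h
  · rw [min_eq_left h]; have hp : (k : ℤ) * c ≤ k * β := mul_le_mul_of_nonneg_left (by exact_mod_cast h) hk0
    simp; split_ifs <;> first | (exfalso; omega) | nlinarith
  · rw [min_eq_right h]; have hp : (k : ℤ) * β ≤ k * c := mul_le_mul_of_nonneg_left (by exact_mod_cast h) hk0
    simp; split_ifs <;> first | (exfalso; omega) | nlinarith

/-- the `V` certificate, both red levels ≥ 1 -/
lemma pv_pp (a ρ : ℕ) (ha : 1 ≤ a) (hρ : 1 ≤ ρ) : phiV k ρ β a c + phiV k a c ρ β ≤ 2 * (k : ℤ) * wvser k a c ρ β := by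
  unfold phiV wvser; simp only [lamV_pos _ _ _ hρ, lamV_pos _ _ _ ha, vw_pos _ _ _ hρ, vw_pos _ _ _ ha]
  have hm : 1 ≤ min a ρ := le_min ha hρ
  have hm0 : ¬ min a ρ = 0 := by omega
  rcases le_total c β with h | h
  · rw [min_eq_left h]; simp [hm, hm0]; split_ifs <;> first | (exfalso; omega) | nlinarith
  · rw [min_eq_right h]; simp [hm, hm0]; split_ifs <;> first | (exfalso; omega) | nlinarith

end casesV

/-- the `V` charges commute -/
lemma phiV_comm (k ρ β a c : ℕ) : phiV k ρ β a c + phiV k a c ρ β = phiV k a c ρ β + phiV k ρ β a c := add_comm _ _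
/-- the `V2_k` product weight is symmetric in the factors -/
lemma wvser_comm (k a c ρ β : ℕ) : wvser k a c ρ β = wvser k ρ β a c := by unfold wvser; rw [min_comm a ρ, min_comm c β]

/-- **The pointwise certificate for the series closure of `V2_k`**. -/
theorem pointwiseV (k a c ρ β : ℕ) (hk : 2 ≤ k) :
    phiV k ρ β a c + phiV k a c ρ β ≤ 2 * (k : ℤ) * wvser k a c ρ β := by
  rcases Nat.eq_zero_or_pos a with ha | ha <;> rcases Nat.eq_zero_or_pos ρ with hρ | hρ
  · subst ha; subst hρ; exact pv_00 k c β hk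
  · subst ha; exact pv_0p k c β hk ρ hρ
  · subst hρ; rw [phiV_comm, wvser_comm]; exact pv_0p k β c hk a ha
  · exact pv_pp k c β hk a ρ ha hρ

/-! ### Domination predicates and the fibre sums -/

/-- `G_k`: every lower set has non-negative `gw k`-mass -/
def GDom [Preorder X] (k : ℕ) (r b : X → ℕ) : Prop :=
  ∀ D : Finset X, IsLowerSet (↑D : Set X) → 0 ≤ ∑ x ∈ D, gw k (r x) (b x)

/-- `V2_k`: every lower set has non-negative `vw k`-mass -/
def VDom [Preorder X] (k : ℕ) (r b : X → ℕ) : Prop :=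
  ∀ D : Finset X, IsLowerSet (↑D : Set X) → 0 ≤ ∑ x ∈ D, vw k (r x) (b x)

/-- the `G` multiplier is non-negative -/
lemma lamA_nonneg (k ρ β : ℕ) : 0 ≤ lamA k ρ β := by unfold lamA; split_ifs <;> positivity
/-- the `V` multiplier (for the `G` target) is non-negative for `k ≥ 1` -/
lemma lamB_nonneg (k ρ β : ℕ) (hk : 1 ≤ k) : 0 ≤ lamB k ρ β := by
  have : (1 : ℤ) ≤ k := by exact_mod_cast hk
  unfold lamB; split_ifs <;> linarith
/-- the `V` multiplier (for the `V` target) is non-negative -/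
lemma lamV_nonneg (k ρ β : ℕ) : 0 ≤ lamV k ρ β := by unfold lamV; split_ifs <;> positivity

/-- `gw k` of the series labels is `wgser` -/
theorem gw_ser_eq (k : ℕ) (r b : X → ℕ) (r' b' : Y → ℕ) (x : X) (y : Y) :
    gw k (min (r x) (r' y)) (min (b x) (b' y)) = wgser k (r x) (b x) (r' y) (b' y) := rfl
/-- `vw k` of the series labels is `wvser` -/
theorem vw_ser_eq (k : ℕ) (r b : X → ℕ) (r' b' : Y → ℕ) (x : X) (y : Y) :
    vw k (min (r x) (r' y)) (min (b x) (b' y)) = wvser k (r x) (b x) (r' y) (b' y) := rfl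

section fibres

variable [Preorder X] [Preorder Y] [Fintype X] [Fintype Y] [DecidableEq X] [DecidableEq Y]

omit [Fintype Y] in
/-- a fibre-summed weight, from a lower-set statement of `X` -/
theorem fibre_fst_of_lower (f : X → ℤ) (hX : ∀ D : Finset X, IsLowerSet (↑D : Set X) → 0 ≤ ∑ x ∈ D, f x)
    (D : Finset (X × Y)) (hD : IsLowerSet (↑D : Set (X × Y))) (y : Y) : 0 ≤ ∑ x, ind D x y * f x := by
  have h := hX (univ.filter (fun x : X => (x, y) ∈ D)) (fibre_fst_isLowerSet D hD y)
  rw [Finset.sum_filter] at h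
  have : ∑ x, ind D x y * f x = ∑ x, (if (x, y) ∈ D then f x else 0) := by
    apply Finset.sum_congr rfl; intro x _; unfold ind; split_ifs <;> simp
  rw [this]; exact h

omit [Fintype X] in
/-- a fibre-summed weight, from a lower-set statement of `Y` -/
theorem fibre_snd_of_lower (f : Y → ℤ) (hY : ∀ D : Finset Y, IsLowerSet (↑D : Set Y) → 0 ≤ ∑ y ∈ D, f y)
    (D : Finset (X × Y)) (hD : IsLowerSet (↑D : Set (X × Y))) (x : X) : 0 ≤ ∑ y, ind D x y * f y := by
  have h := hY (univ.filter (fun y : Y => (x, y) ∈ D)) (fibre_snd_isLowerSet D hD x)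
  rw [Finset.sum_filter] at h
  have : ∑ y, ind D x y * f y = ∑ y, (if (x, y) ∈ D then f y else 0) := by
    apply Finset.sum_congr rfl; intro y _; unfold ind; split_ifs <;> simp
  rw [this]; exact h

omit [Fintype Y] in
/-- the `G` charge of the fibre over `y` is non-negative -/
theorem fibre_phiG_fst (k : ℕ) (hk : 1 ≤ k) (r b : X → ℕ) (hG : GDom k r b) (hV : VDom k r b)
    (D : Finset (X × Y)) (hD : IsLowerSet (↑D : Set (X × Y))) (ρ β : ℕ) (y : Y) :
    0 ≤ ∑ x, ind D x y * phiG k ρ β (r x) (b x) := by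
  have e : ∑ x, ind D x y * phiG k ρ β (r x) (b x)
      = lamA k ρ β * ∑ x, ind D x y * gw k (r x) (b x) + lamB k ρ β * ∑ x, ind D x y * vw k (r x) (b x) := by
    rw [Finset.mul_sum, Finset.mul_sum, ← Finset.sum_add_distrib]
    apply Finset.sum_congr rfl; intro x _; unfold phiG; ring
  rw [e]
  exact add_nonneg (mul_nonneg (lamA_nonneg k ρ β) (fibre_fst_of_lower _ hG D hD y))
    (mul_nonneg (lamB_nonneg k ρ β hk) (fibre_fst_of_lower _ hV D hD y))

omit [Fintype X] in
/-- the `G` charge of the fibre over `x` is non-negative -/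
theorem fibre_phiG_snd (k : ℕ) (hk : 1 ≤ k) (r' b' : Y → ℕ) (hG : GDom k r' b') (hV : VDom k r' b')
    (D : Finset (X × Y)) (hD : IsLowerSet (↑D : Set (X × Y))) (ρ β : ℕ) (x : X) :
    0 ≤ ∑ y, ind D x y * phiG k ρ β (r' y) (b' y) := by
  have e : ∑ y, ind D x y * phiG k ρ β (r' y) (b' y)
      = lamA k ρ β * ∑ y, ind D x y * gw k (r' y) (b' y) + lamB k ρ β * ∑ y, ind D x y * vw k (r' y) (b' y) := by
    rw [Finset.mul_sum, Finset.mul_sum, ← Finset.sum_add_distrib]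
    apply Finset.sum_congr rfl; intro y _; unfold phiG; ring
  rw [e]
  exact add_nonneg (mul_nonneg (lamA_nonneg k ρ β) (fibre_snd_of_lower _ hG D hD x))
    (mul_nonneg (lamB_nonneg k ρ β hk) (fibre_snd_of_lower _ hV D hD x))

/-- **`G_k` is closed under series composition, given `G_k ∧ V2_k` on the parts** (`k ≥ 2`). -/
theorem gDom_ser (k : ℕ) (hk : 2 ≤ k) (r b : X → ℕ) (r' b' : Y → ℕ)
    (hG : GDom k r b) (hV : VDom k r b) (hG' : GDom k r' b') (hV' : VDom k r' b') :
    GDom k (fun p : X × Y => min (r p.1) (r' p.2)) (fun p : X × Y => min (b p.1) (b' p.2)) := by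
  intro D hD
  have key : ∀ p ∈ D, phiG k (r' p.2) (b' p.2) (r p.1) (b p.1) + phiG k (r p.1) (b p.1) (r' p.2) (b' p.2)
      ≤ 2 * (k : ℤ) * gw k (min (r p.1) (r' p.2)) (min (b p.1) (b' p.2)) := by
    intro p _; obtain ⟨x, y⟩ := p; rw [gw_ser_eq]; exact pointwiseG k _ _ _ _ hk
  have hsum := Finset.sum_le_sum key
  rw [← Finset.mul_sum, Finset.sum_add_distrib] at hsum
  have h1 : 0 ≤ ∑ p ∈ D, phiG k (r' p.2) (b' p.2) (r p.1) (b p.1) := by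
    rw [sum_D_eq' D (fun x y => phiG k (r' y) (b' y) (r x) (b x)), Finset.sum_comm]
    exact Finset.sum_nonneg (fun y _ => fibre_phiG_fst k (by omega) r b hG hV D hD (r' y) (b' y) y)
  have h2 : 0 ≤ ∑ p ∈ D, phiG k (r p.1) (b p.1) (r' p.2) (b' p.2) := by
    rw [sum_D_eq' D (fun x y => phiG k (r x) (b x) (r' y) (b' y))]
    exact Finset.sum_nonneg (fun x _ => fibre_phiG_snd k (by omega) r' b' hG' hV' D hD (r x) (b x) x)
  have hk0 : (0 : ℤ) < 2 * k := by positivity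
  rcases lt_or_ge (∑ p ∈ D, gw k (min (r p.1) (r' p.2)) (min (b p.1) (b' p.2))) 0 with hneg | hpos
  · exfalso; have := mul_neg_of_pos_of_neg hk0 hneg; linarith
  · exact hpos

/-- **`V2_k` is closed under series composition** (`k ≥ 2`). -/
theorem vDom_ser (k : ℕ) (hk : 2 ≤ k) (r b : X → ℕ) (r' b' : Y → ℕ) (hV : VDom k r b) (hV' : VDom k r' b') :
    VDom k (fun p : X × Y => min (r p.1) (r' p.2)) (fun p : X × Y => min (b p.1) (b' p.2)) := by
  intro D hD
  have key : ∀ p ∈ D, phiV k (r' p.2) (b' p.2) (r p.1) (b p.1) + phiV k (r p.1) (b p.1) (r' p.2) (b' p.2)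
      ≤ 2 * (k : ℤ) * vw k (min (r p.1) (r' p.2)) (min (b p.1) (b' p.2)) := by
    intro p _; obtain ⟨x, y⟩ := p; rw [vw_ser_eq]; exact pointwiseV k _ _ _ _ hk
  have hsum := Finset.sum_le_sum key
  rw [← Finset.mul_sum, Finset.sum_add_distrib] at hsum
  have h1 : 0 ≤ ∑ p ∈ D, phiV k (r' p.2) (b' p.2) (r p.1) (b p.1) := by
    rw [sum_D_eq' D (fun x y => phiV k (r' y) (b' y) (r x) (b x)), Finset.sum_comm]
    refine Finset.sum_nonneg (fun y _ => ?_)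
    have e : ∑ x, ind D x y * phiV k (r' y) (b' y) (r x) (b x) = lamV k (r' y) (b' y) * ∑ x, ind D x y * vw k (r x) (b x) := by
      rw [Finset.mul_sum]; apply Finset.sum_congr rfl; intro x _; unfold phiV; ring
    rw [e]; exact mul_nonneg (lamV_nonneg _ _ _) (fibre_fst_of_lower _ hV D hD y)
  have h2 : 0 ≤ ∑ p ∈ D, phiV k (r p.1) (b p.1) (r' p.2) (b' p.2) := by
    rw [sum_D_eq' D (fun x y => phiV k (r x) (b x) (r' y) (b' y))]
    refine Finset.sum_nonneg (fun x _ => ?_)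
    have e : ∑ y, ind D x y * phiV k (r x) (b x) (r' y) (b' y) = lamV k (r x) (b x) * ∑ y, ind D x y * vw k (r' y) (b' y) := by
      rw [Finset.mul_sum]; apply Finset.sum_congr rfl; intro y _; unfold phiV; ring
    rw [e]; exact mul_nonneg (lamV_nonneg _ _ _) (fibre_snd_of_lower _ hV' D hD x)
  have hk0 : (0 : ℤ) < 2 * k := by positivity
  rcases lt_or_ge (∑ p ∈ D, vw k (min (r p.1) (r' p.2)) (min (b p.1) (b' p.2))) 0 with hneg | hpos
  · exfalso; have := mul_neg_of_pos_of_neg hk0 hneg; linarith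
  · exact hpos

end fibres

/-! ### Parallel closure of `G_k` -/

/-- the weight of `G_k` on the parallel (sum) product -/
def wgpar (k a c ρ β : ℕ) : ℤ :=
  (if a + ρ = 1 ∧ k - 1 ≤ c + β then 1 else 0) - (if a + ρ = 0 ∧ k ≤ c + β then ((c + β : ℕ) : ℤ) else 0)

/-- the parallel certificate: a fibre with red label 0 and blue label `β` charges `G_{k − β}` -/
def psiG (k ρ β a c : ℕ) : ℤ := if ρ = 0 then gw (k - β) a c else 0

/-- `gw k` of the sum labels is `wgpar` -/
theorem gw_par_eq (k : ℕ) (r b : X → ℕ) (r' b' : Y → ℕ) (x : X) (y : Y) :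
    gw k (r x + r' y) (b x + b' y) = wgpar k (r x) (b x) (r' y) (b' y) := rfl

/-- **The pointwise certificate for the parallel closure of `G_k`.** -/
theorem pointwiseGpar (k a c ρ β : ℕ) : psiG k ρ β a c + psiG k a c ρ β ≤ wgpar k a c ρ β := by
  unfold psiG gw wgpar
  split_ifs <;> push_cast <;> omega

section fibresPar

variable [Preorder X] [Preorder Y] [Fintype X] [Fintype Y] [DecidableEq X] [DecidableEq Y]

omit [Fintype Y] in
/-- the parallel `G` charge of the fibre over `y` is non-negative -/
theorem fibre_psiG_fst (k : ℕ) (r b : X → ℕ) (hG : ∀ j, GDom j r b)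
    (D : Finset (X × Y)) (hD : IsLowerSet (↑D : Set (X × Y))) (ρ β : ℕ) (y : Y) :
    0 ≤ ∑ x, ind D x y * psiG k ρ β (r x) (b x) := by
  unfold psiG
  split_ifs
  · exact fibre_fst_of_lower _ (hG (k - β)) D hD y
  · simp

omit [Fintype X] in
/-- the parallel `G` charge of the fibre over `x` is non-negative -/
theorem fibre_psiG_snd (k : ℕ) (r' b' : Y → ℕ) (hG : ∀ j, GDom j r' b')
    (D : Finset (X × Y)) (hD : IsLowerSet (↑D : Set (X × Y))) (ρ β : ℕ) (x : X) :
    0 ≤ ∑ y, ind D x y * psiG k ρ β (r' y) (b' y) := by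
  unfold psiG
  split_ifs
  · exact fibre_snd_of_lower _ (hG (k - β)) D hD x
  · simp

/-- **`G_k` is closed under parallel composition, given all levels `G_j` on the parts.** -/
theorem gDom_par (k : ℕ) (r b : X → ℕ) (r' b' : Y → ℕ) (hG : ∀ j, GDom j r b) (hG' : ∀ j, GDom j r' b') :
    GDom k (fun p : X × Y => r p.1 + r' p.2) (fun p : X × Y => b p.1 + b' p.2) := by
  intro D hD
  have key : ∀ p ∈ D, psiG k (r' p.2) (b' p.2) (r p.1) (b p.1) + psiG k (r p.1) (b p.1) (r' p.2) (b' p.2)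
      ≤ gw k (r p.1 + r' p.2) (b p.1 + b' p.2) := by
    intro p _; obtain ⟨x, y⟩ := p; rw [gw_par_eq]; exact pointwiseGpar k _ _ _ _
  have hsum := Finset.sum_le_sum key
  rw [Finset.sum_add_distrib] at hsum
  have h1 : 0 ≤ ∑ p ∈ D, psiG k (r' p.2) (b' p.2) (r p.1) (b p.1) := by
    rw [sum_D_eq' D (fun x y => psiG k (r' y) (b' y) (r x) (b x)), Finset.sum_comm]
    exact Finset.sum_nonneg (fun y _ => fibre_psiG_fst k r b hG D hD (r' y) (b' y) y)
  have h2 : 0 ≤ ∑ p ∈ D, psiG k (r p.1) (b p.1) (r' p.2) (b' p.2) := by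
    rw [sum_D_eq' D (fun x y => psiG k (r x) (b x) (r' y) (b' y))]
    exact Finset.sum_nonneg (fun x _ => fibre_psiG_snd k r' b' hG' D hD (r x) (b x) x)
  linarith

end fibresPar

end Summit.Ventures.PercRepro2.UHClosure
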